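import Mathlib
import Literature.Analysis.FluidPDE.ClassicalSolution
import Literature.Analysis.FluidPDE.LerayHopf
import Literature.Analysis.FluidPDE.NSWave0
import Literature.Analysis.FluidPDE.NormalisedPressureDischarge
import Summits.NavierStokesRegularity.NavierStokesRegularity.Theorems.SlicedKelvinPlanarFluxAPrioriStubDecayPersistence
import Summits.NavierStokesRegularity.NavierStokesRegularity.Theorems.PlaneEnergyCeilingPlanarEnergyAPrioriPressureDecay

/-!
# Route PlaneEnergyCeiling · crux `PlanarEnergyAPriori` · line `birth` — STUB 2 `stub_decayPersistence`

Lands `--supports stmt-NavierStokesRegularity-16855` the registered stub `stub_decayPersistence` of the birth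
skeleton `Cruxes/PlanarEnergyAPriori/Lines/birth.lean`: ORDER-(3,2) SPATIAL DECAY PERSISTS along a classical
Leray–Hopf solution `(u, p)` of the unforced Navier–Stokes system on `ℝ³ × [0, T)` from a rapidly decaying
datum — for every `t < T` there are `C₀` and a pressure constant `π₀(s)` with
`(1 + |x|)³ (|u| + ‖Du‖ + ‖D²u‖)(s, x) ≤ C₀` and `(1 + |x|)² (|p(s, x) - π₀(s)| + ‖∇p(s, x)‖) ≤ C₀` on
`[0, t] × ℝ³`.

## Proof

Everything is a theorem of the tree; no named fact is assumed.

1. (*velocity*) Cubic decay of `u, Du, D²u, D³u` on the closed slab `[0, T₁]`, `T₁ = (t + T)/2`, is the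
   sibling route's `Theorems.SlicedKelvinPlanarFluxAPriori.stub_decayPersistence` (Brandolese 2004;
   Kukavica–Torres 2006: Tao's bounds on closed slabs, the Oseen representation, a weighted bootstrap).
2. (*pressure, interior times*) On `[0, T₁]` the solution has finite energy (`|u|² ≤ C²(1 + |y|)⁻⁶`), so by
   Tao's pressure normalisation (Tao 2013, Lemma 4.1 (i): `pressure_sub_pressurePotential_eq`,
   `FluidPDE/NormalisedPressureDischarge`) `p(s, ·) = Q[u(s)] + π₀(s)` for `0 < s < T₁`, with
   `Q[v] = -Δ⁻¹∂ᵢ∂ⱼ(vᵢvⱼ)` Tao's pressure potential and `π₀(s) = p(s, 0) - Q[u(s)](0)`; hence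
   `∇p(s, ·) = ∇Q[u(s)]`, and `(1 + |x|)² (|Q| + ‖DQ‖) ≤ K C²`
   (`PressureDecay.exists_pressurePotential_decay_const`).
3. (*pressure, `s = 0`*) The gradient bound passes to `s = 0` by the joint continuity of `∇p`; for the value,
   `π₀(sₙ)` is bounded along `sₙ ↓ 0`, and along a convergent subsequence `π₀(s_{φ(n)}) → L`
   (Bolzano–Weierstrass) the bound `(1 + |x|)² |p(s_{φ(n)}, x) - π₀(s_{φ(n)})| ≤ K C²` passes to the limit
   `(1 + |x|)² |p(0, x) - L| ≤ K C²`; set `π₀(0) = L`.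

## References

* L. Brandolese, Math. Ann. 329 (2004) = arXiv:math/0403136.
* I. Kukavica, J. J. Torres, Nonlinearity 19 (2006).
* T. Tao, Anal. PDE 6 (2013) = arXiv:1108.1165, Lemma 4.1 (i), Cor. 11.1.
-/

noncomputable section

-- single-conjunct summit: `Summit.<Summit>.<Problem>` repeats the name by the D-0017 layout
set_option linter.dupNamespace false

namespace Summit.NavierStokesRegularity.NavierStokesRegularity.Theorems.PlanarEnergyAPriori

open MeasureTheory Set Filter Metric Topology Function Real
open scoped ContDiff ENNReal
open Literature.Analysis.FluidPDE


/-- `‖∇f(x)‖ = ‖Df(x)‖` (the gradient is the Riesz representative of the derivative). -/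
theorem norm_gradient_eq_norm_fderiv (f : (EuclideanSpace ℝ (Fin 3)) → ℝ) (x : (EuclideanSpace ℝ (Fin 3))) : ‖gradient f x‖ = ‖fderiv ℝ f x‖ := by
  rw [gradient, LinearIsometryEquiv.norm_map]

/-- **The pressure at interior times of a closed slab.** For a classical solution of the unforced system on
`[0, T₁] × ℝ³` whose velocity slices have cubic decay of order `≤ 3` with constant `C`, and `0 < s < T₁`:
`(1 + |x|)² |p(s, x) - (p(s, 0) - Q[u(s)](0))| ≤ K C²` and `(1 + |x|)² ‖∇p(s, x)‖ ≤ K C²`, where `K` is the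
constant of `PressureDecay.exists_pressurePotential_decay_const` (Tao's normalisation + decay of `Q`). -/
theorem pressure_decay_interior {ν T₁ : ℝ} (hν : 0 < ν)
    {u : ℝ → (EuclideanSpace ℝ (Fin 3)) → (EuclideanSpace ℝ (Fin 3))} {p : ℝ → (EuclideanSpace ℝ (Fin 3)) → ℝ} (hcl : IsClassicalNSSolutionOn (Icc 0 T₁) ν 0 u p) {C : ℝ}
    (hC : ∀ s ∈ Icc 0 T₁, ∀ (y : (EuclideanSpace ℝ (Fin 3))) (k : ℕ), k ≤ 3 → (1 + ‖y‖) ^ 3 * ‖iteratedFDeriv ℝ k (u s) y‖ ≤ C)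
    {K : ℝ} (hK : ∀ (C : ℝ) (v : (EuclideanSpace ℝ (Fin 3)) → (EuclideanSpace ℝ (Fin 3))), ContDiff ℝ ∞ v → VectorCalculus.IsDivFree v →
      (∀ (y : (EuclideanSpace ℝ (Fin 3))) (k : ℕ), k ≤ 3 → (1 + ‖y‖) ^ 3 * ‖iteratedFDeriv ℝ k v y‖ ≤ C) →
      ∀ x : (EuclideanSpace ℝ (Fin 3)), (1 + ‖x‖) ^ 2 * |pressurePotential v x| ≤ K * C ^ 2 ∧
        (1 + ‖x‖) ^ 2 * ‖fderiv ℝ (pressurePotential v) x‖ ≤ K * C ^ 2)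
    {s : ℝ} (hs : s ∈ Ioo 0 T₁) (x : (EuclideanSpace ℝ (Fin 3))) :
    (1 + ‖x‖) ^ 2 * |p s x - (p s 0 - pressurePotential (u s) 0)| ≤ K * C ^ 2 ∧
      (1 + ‖x‖) ^ 2 * ‖gradient (p s) x‖ ≤ K * C ^ 2 := by
  -- finite energy on the slab, from the decay
  obtain ⟨I, hI⟩ : ∃ I : ℝ, I = ∫ y : (EuclideanSpace ℝ (Fin 3)), (1 + ‖y‖) ^ (-(6 : ℝ)) := ⟨_, rfl⟩
  have hint : ∀ τ ∈ Icc 0 T₁, Integrable fun y => ‖u τ y‖ ^ 2 := fun τ hτ =>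
    (PressureDecay.integrable_norm_sq (hcl.contDiff_velocity hτ).continuous (hC τ hτ)).1
  have hE : ∀ τ ∈ Icc 0 T₁, ∫ y, ‖u τ y‖ ^ 2 ≤ C ^ 2 * I := fun τ hτ => by
    rw [hI]; exact (PressureDecay.integrable_norm_sq (hcl.contDiff_velocity hτ).continuous (hC τ hτ)).2
  have hE0 : 0 ≤ C ^ 2 * I := by
    rw [hI]; exact mul_nonneg (sq_nonneg C) (integral_nonneg fun y => by positivity)
  -- Tao's normalisation at the interior time `s`
  have hsI : s ∈ Icc 0 T₁ := Ioo_subset_Icc_self hs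
  have hnorm : ∀ y, p s y - pressurePotential (u s) y = p s 0 - pressurePotential (u s) 0 := fun y =>
    pressure_sub_pressurePotential_eq hν.le hcl hE0 hint hE hs y
  have hps : p s = fun y => pressurePotential (u s) y + (p s 0 - pressurePotential (u s) 0) :=
    funext fun y => by linarith [hnorm y]
  -- decay of the potential and its gradient
  obtain ⟨hQ, hDQ⟩ := hK C (u s) (hcl.contDiff_velocity hsI) (hcl.divFree s hsI) (hC s hsI) x
  refine ⟨?_, ?_⟩
  · have e : p s x - (p s 0 - pressurePotential (u s) 0) = pressurePotential (u s) x := by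
      linarith [hnorm x]
    rw [e]; exact hQ
  · have e : fderiv ℝ (p s) x = fderiv ℝ (pressurePotential (u s)) x := by
      rw [hps]; exact fderiv_add_const _
    rw [norm_gradient_eq_norm_fderiv, e]; exact hDQ

/-- **STUB `stub_decayPersistence` of the birth skeleton of `PlaneEnergyCeiling.PlanarEnergyAPriori`
(item stmt-NavierStokesRegularity-16855): ORDER-(3,2) SPATIAL DECAY PERSISTS** along a classical Leray–Hopf
solution from a rapidly decaying datum, uniformly on every compact `[0, t] ⊂ [0, T)`:
`(1 + |x|)³ (|u| + ‖Du‖ + ‖D²u‖) ≤ C₀` and, for a pressure constant `π₀(s)`,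
`(1 + |x|)² (|p - π₀(s)| + ‖∇p‖) ≤ C₀` (module docstring: the velocity from the sibling route's decay stub, the
pressure from Tao's normalisation and the quadratic decay of the pressure potential; Brandolese 2004,
Kukavica–Torres 2006, Tao 2013 Lemma 4.1 (i)). -/
theorem stub_decayPersistence :
    ∀ (ν T : ℝ), 0 < ν → 0 < T → ∀ (u : ℝ → EuclideanSpace ℝ (Fin 3) → EuclideanSpace ℝ (Fin 3)) (p : ℝ → EuclideanSpace ℝ (Fin 3) → ℝ), Literature.Analysis.FluidPDE.IsClassicalNSSolutionOn (Set.Ico 0 T) ν 0 u p → Literature.Analysis.FluidPDE.IsLerayHopfOn T ν 0 (u 0) u → Literature.Analysis.FluidPDE.HasRapidSpatialDecay (u 0) → ∀ t ∈ Set.Ico 0 T, ∃ (C₀ : ℝ) (π₀ : ℝ → ℝ), ∀ s ∈ Set.Icc 0 t, ∀ x : EuclideanSpace ℝ (Fin 3), (1 + ‖x‖) ^ 3 * ‖u s x‖ ≤ C₀ ∧ (1 + ‖x‖) ^ 3 * ‖fderiv ℝ (u s) x‖ ≤ C₀ ∧ (1 + ‖x‖) ^ 3 * ‖iteratedFDeriv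 ℝ 2 (u s) x‖ ≤ C₀ ∧ (1 + ‖x‖) ^ 2 * |p s x - π₀ s| ≤ C₀ ∧ (1 + ‖x‖) ^ 2 * ‖gradient (p s) x‖ ≤ C₀ := by
  intro ν T hν hT u p hcl hLH hdec t ht
  -- the closed slab `[0, T₁]`, `t < T₁ < T`
  obtain ⟨T₁, hT₁⟩ : ∃ T₁ : ℝ, T₁ = (t + T) / 2 := ⟨_, rfl⟩
  have hT₁' : T₁ ∈ Ioo 0 T := ⟨by rw [hT₁]; linarith [ht.1, ht.2], by rw [hT₁]; linarith [ht.2]⟩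
  have htT₁ : t < T₁ := by rw [hT₁]; linarith [ht.2]
  have hcl₁ : IsClassicalNSSolutionOn (Icc 0 T₁) ν 0 u p :=
    hcl.mono (Icc_subset_Ico_right hT₁'.2) (uniqueDiffOn_Icc hT₁'.1)
  -- Step 1: velocity decay on `[0, T₁]`
  obtain ⟨C, hC⟩ := SlicedKelvinPlanarFluxAPriori.stub_decayPersistence ν T hν hT u p hcl hLH hdec T₁
    ⟨hT₁'.1.le, hT₁'.2⟩
  have hC0 : 0 ≤ C := PressureDecay.const_nonneg (hC 0 ⟨le_rfl, hT₁'.1.le⟩)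
  -- Step 2: the pressure at interior times
  obtain ⟨K, hK0, hK⟩ := PressureDecay.exists_pressurePotential_decay_const
  have hint : ∀ s ∈ Ioo 0 T₁, ∀ x : (EuclideanSpace ℝ (Fin 3)),
      (1 + ‖x‖) ^ 2 * |p s x - (p s 0 - pressurePotential (u s) 0)| ≤ K * C ^ 2 ∧
        (1 + ‖x‖) ^ 2 * ‖gradient (p s) x‖ ≤ K * C ^ 2 := fun s hs x =>
    pressure_decay_interior hν hcl₁ hC hK hs x
  -- Step 3a: the gradient at `s = 0` by continuity in time
  have hgrad0 : ∀ x : (EuclideanSpace ℝ (Fin 3)), (1 + ‖x‖) ^ 2 * ‖gradient (p 0) x‖ ≤ K * C ^ 2 := by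
    intro x
    have hsm := (hcl₁.smooth_pressure.gradient (uniqueDiffOn_Icc hT₁'.1)).continuousOn
    have hc : ContinuousWithinAt (fun s : ℝ => gradient (p s) x) (Icc 0 T₁) 0 := by
      have h1 : Continuous (fun s : ℝ => ((s, x) : ℝ × (EuclideanSpace ℝ (Fin 3)))) := continuous_id.prodMk continuous_const
      have h2 := hsm.comp (f := fun s : ℝ => ((s, x) : ℝ × (EuclideanSpace ℝ (Fin 3)))) h1.continuousOn
        (fun s hs => mk_mem_prod hs (mem_univ x))
      exact h2.continuousWithinAt ⟨le_rfl, hT₁'.1.le⟩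
    have hc' : Tendsto (fun s : ℝ => (1 + ‖x‖) ^ 2 * ‖gradient (p s) x‖) (𝓝[Ioo 0 T₁] 0)
        (𝓝 ((1 + ‖x‖) ^ 2 * ‖gradient (p 0) x‖)) :=
      ((hc.mono Ioo_subset_Icc_self).tendsto.norm).const_mul _
    haveI : (𝓝[Ioo 0 T₁] (0 : ℝ)).NeBot := by
      rw [nhdsWithin_Ioo_eq_nhdsGT hT₁'.1]; infer_instance
    exact le_of_tendsto hc' (eventually_nhdsWithin_of_forall fun s hs => (hint s hs x).2)
  -- Step 3b: the value at `s = 0` along a subsequence of `sₙ ↓ 0`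
  obtain ⟨sq, hsq⟩ : ∃ sq : ℕ → ℝ, sq = fun n : ℕ => T₁ / 2 * (1 / ((n : ℝ) + 1)) := ⟨_, rfl⟩
  have hsq_mem : ∀ n, sq n ∈ Ioo 0 T₁ := fun n => by
    have hn : (0 : ℝ) < (n : ℝ) + 1 := by positivity
    have e : sq n = T₁ / 2 * (1 / ((n : ℝ) + 1)) := by rw [hsq]
    rw [e]
    refine ⟨mul_pos (by linarith [hT₁'.1]) (by positivity), ?_⟩
    have : 1 / ((n : ℝ) + 1) ≤ 1 := by rw [div_le_one hn]; linarith
    calc T₁ / 2 * (1 / ((n : ℝ) + 1)) ≤ T₁ / 2 * 1 := by gcongr; linarith [hT₁'.1]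
      _ < T₁ := by linarith [hT₁'.1]
  have hsq_lim : Tendsto sq atTop (𝓝 0) := by
    have := (tendsto_one_div_add_atTop_nhds_zero_nat (𝕜 := ℝ)).const_mul (T₁ / 2)
    rw [mul_zero] at this
    rw [hsq]
    exact this
  -- the constants `π(sₙ) = p(sₙ, 0) - Q[u(sₙ)](0)` are bounded
  obtain ⟨Mp, hMp⟩ := hcl₁.smooth_pressure.exists_bound isCompact_Icc (isCompact_singleton (x := (0 : (EuclideanSpace ℝ (Fin 3)))))
  obtain ⟨πs, hπs⟩ : ∃ πs : ℕ → ℝ, πs = fun n : ℕ => p (sq n) 0 - pressurePotential (u (sq n)) 0 :=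
    ⟨_, rfl⟩
  have hπs_bdd : ∀ n, πs n ∈ Icc (-(Mp + K * C ^ 2)) (Mp + K * C ^ 2) := by
    intro n
    have h1 : |p (sq n) 0| ≤ Mp := by
      rw [← Real.norm_eq_abs]; exact hMp _ (Ioo_subset_Icc_self (hsq_mem n)) 0 rfl
    have h2 : |p (sq n) 0 - πs n| ≤ K * C ^ 2 := by
      have := (hint (sq n) (hsq_mem n) 0).1
      simpa [hπs] using this
    rw [mem_Icc, ← abs_le]
    calc |πs n| = |p (sq n) 0 - (p (sq n) 0 - πs n)| := by ring_nf
      _ ≤ |p (sq n) 0| + |p (sq n) 0 - πs n| := abs_sub _ _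
      _ ≤ Mp + K * C ^ 2 := add_le_add h1 h2
  obtain ⟨L, -, φ, hφ, hL⟩ := tendsto_subseq_of_bounded (isBounded_Icc _ _) hπs_bdd
  -- the pressure constant
  refine ⟨max C (K * C ^ 2), fun s => if 0 < s then p s 0 - pressurePotential (u s) 0 else L, ?_⟩
  intro s hs x
  have hsT₁ : s ∈ Icc 0 T₁ := ⟨hs.1, (hs.2.trans_lt htT₁).le⟩
  -- the velocity bounds
  have hv0 : (1 + ‖x‖) ^ 3 * ‖u s x‖ ≤ max C (K * C ^ 2) := by
    have := hC s hsT₁ x 0 (by norm_num)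
    rw [norm_iteratedFDeriv_zero] at this
    exact this.trans (le_max_left _ _)
  have hv1 : (1 + ‖x‖) ^ 3 * ‖fderiv ℝ (u s) x‖ ≤ max C (K * C ^ 2) := by
    have := hC s hsT₁ x 1 (by norm_num)
    rw [← norm_iteratedFDeriv_fderiv, norm_iteratedFDeriv_zero] at this
    exact this.trans (le_max_left _ _)
  have hv2 : (1 + ‖x‖) ^ 3 * ‖iteratedFDeriv ℝ 2 (u s) x‖ ≤ max C (K * C ^ 2) :=
    (hC s hsT₁ x 2 (by norm_num)).trans (le_max_left _ _)
  refine ⟨hv0, hv1, hv2, ?_, ?_⟩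
  · -- the pressure value
    rcases eq_or_lt_of_le hs.1 with h0 | hspos
    · -- `s = 0`: the limit along the subsequence
      subst h0
      dsimp only
      rw [if_neg (lt_irrefl 0)]
      -- `p (sq (φ n)) x → p 0 x`
      have hpc : ContinuousWithinAt (fun s : ℝ => p s x) (Icc 0 T₁) 0 := by
        have h1 : Continuous (fun s : ℝ => ((s, x) : ℝ × (EuclideanSpace ℝ (Fin 3)))) := continuous_id.prodMk continuous_const
        have h2 := hcl₁.smooth_pressure.continuousOn.comp (f := fun s : ℝ => ((s, x) : ℝ × (EuclideanSpace ℝ (Fin 3))))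
          h1.continuousOn (fun s hs => mk_mem_prod hs (mem_univ x))
        exact h2.continuousWithinAt ⟨le_rfl, hT₁'.1.le⟩
      have hseq : Tendsto (sq ∘ φ) atTop (𝓝[Icc 0 T₁] 0) :=
        tendsto_nhdsWithin_iff.2 ⟨hsq_lim.comp hφ.tendsto_atTop,
          Eventually.of_forall fun n => Ioo_subset_Icc_self (hsq_mem (φ n))⟩
      have hp0 : Tendsto (fun n => p (sq (φ n)) x) atTop (𝓝 (p 0 x)) := hpc.tendsto.comp hseq
      have hlim : Tendsto (fun n => (1 + ‖x‖) ^ 2 * |p (sq (φ n)) x - πs (φ n)|) atTop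
          (𝓝 ((1 + ‖x‖) ^ 2 * |p 0 x - L|)) :=
        ((hp0.sub hL).abs).const_mul _
      have hbound : (1 + ‖x‖) ^ 2 * |p 0 x - L| ≤ K * C ^ 2 := by
        refine le_of_tendsto' hlim fun n => ?_
        have := (hint (sq (φ n)) (hsq_mem (φ n)) x).1
        simpa [hπs] using this
      exact hbound.trans (le_max_right _ _)
    · dsimp only
      rw [if_pos hspos]
      exact ((hint s ⟨hspos, hs.2.trans_lt htT₁⟩ x).1).trans (le_max_right _ _)
  · -- the pressure gradient
    rcases eq_or_lt_of_le hs.1 with h0 | hspos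
    · subst h0; exact (hgrad0 x).trans (le_max_right _ _)
    · exact ((hint s ⟨hspos, hs.2.trans_lt htT₁⟩ x).2).trans (le_max_right _ _)

end Summit.NavierStokesRegularity.NavierStokesRegularity.Theorems.PlanarEnergyAPriori

end
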